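import Summits.AnomalousDissipation.AnomalousDissipation.Theses.MirrorVariety
import Summits.AnomalousDissipation.AnomalousDissipation.Theorems.TaylorGreenLoudGalerkinStates.Negative.Anatomy

/-!
# Negative knowledge for the crux `TaylorGreenLogLoudStates` (stmt-AnomalousDissipation-14586, route MirrorVariety), I:
# load-bearing analysis — the force, the log window, the resolution

Certified copy of §0–§2(c) of the cdisprove work file `Cruxes/TaylorGreenLogLoudStates/Disproof.lean`
(refuter-cdisprove-stmt-AnomalousDissipation-14586-0, cycle 1). Supports stmt-AnomalousDissipation-14586; no positive
route-item statement is asserted. Builds on the landed sibling files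
`Theorems/TaylorGreenLoudGalerkinStates/Negative/{LoadBearing,Anatomy}` (`tgForce`, `IsSteadyState`, `energy_identity`,
`loudness_le_half_sqrt_energy`, `resolution_floor`, `integral_inner_tgForce_eq_sum`, …). Part II (`Ceilings.lean`):
a-priori ceilings, the relation to crux #2, and `not_logCrux_iff`.

* `logCrux_iff` — crux ↔ `LogLoudStates tgForce` (the `∀ f, f = f_TG →` binder is sugar, `rfl`).
* §1 `log_four_le_log_one_div`, `log_one_div_pos`, `tendsto_mul_log_one_div` (`ν_j log(1/ν_j) → 0`),
  `tendsto_log_one_div_atTop`.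
* (a) `logLoud_false_without_force` — the force-free weakening is FALSE (`f = 0`: loudness = injection = 0).
* (b) `log_window` (`4c² ≤ E·log(1/ν_j)` for EVERY `j`), `logLoud_pos_E` (`E > 0` forced),
  `not_logLoud_of_energy_lt_four_sq` (strengthening `E log(1/ν_j) < 4c²` at some `j`: FALSE),
  `not_logLoud_linear_loudness` (strengthening "loudness `≥ c·log(1/ν_j)`": FALSE — the loudness exponent is `≤ ½`).
* (c) `log_resolution_floor` (`c ≤ 4π²ν N² E log(1/ν)`: witnesses live at `N_j ≳ (ν_j log(1/ν_j))^{-1/2}`),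
  `not_logLoud_at_every_resolution` (`∀ N` for `∀ᶠ N`: FALSE, `N = 0`), `freqNormSq_of_mem_tgShell`,
  `injection_eq_zero_of_resolution_le_one` / `not_loud_at_resolution_le_one` (TG-specific: at `N ≤ 1` the Galerkin system
  does not see the forcing shell `|k|² = 3` — every admissible state has zero injection; the threshold in `∀ᶠ N` is `≥ 2`),
  `not_logLoud_at_fixed_resolution` (`∃ N ∀ j`: FALSE), `not_logLoud_uniformly_in_resolution` (`∀ᶠ N, ∀ j`: FALSE).
-/

noncomputable section

open scoped InnerProductSpace Topology
open MeasureTheory Filter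
open Literature.Analysis.FunctionSpaces Literature.Analysis.FunctionSpaces.Torus
open Summit.AnomalousDissipation.AnomalousDissipation.Theorems.TaylorGreenLoudGalerkinStates.Negative

namespace Summit.AnomalousDissipation.AnomalousDissipation.Theorems.TaylorGreenLogLoudStates.Negative

/-! ## §0 Vocabulary (transparent restatements of the crux's own clauses)

`tgForce`, `IsBandLimited`, `IsSteadyState` are the sibling crux's landed vocabulary
(`Theorems/TaylorGreenLoudGalerkinStates/Negative/LoadBearing.lean`), verbatim the bracket shared by #2 and #3. -/

/-- The log crux's matrix: along `ν`, with constants `E`, `c`, for every `j` and all large `N` an admissible state with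
energy `≤ E·log(1/ν_j)` and loudness `≥ c`. -/
def LogLoudAlong (f : UnitAddTorus (Fin 3) → EuclideanSpace ℝ (Fin 3)) (ν : ℕ → ℝ) (E c : ℝ) : Prop :=
  ∀ j, ∀ᶠ N in atTop, ∃ U : UnitAddTorus (Fin 3) → EuclideanSpace ℝ (Fin 3),
    IsSteadyState (ν j) N f U ∧ ∫ x, ‖U x‖ ^ 2 ≤ E * Real.log (1 / ν j) ∧ c ≤ ν j * gradNormSq U

/-- The log crux's conclusion for a general force `f`. -/
def LogLoudStates (f : UnitAddTorus (Fin 3) → EuclideanSpace ℝ (Fin 3)) : Prop :=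
  ∃ (ν : ℕ → ℝ) (E c : ℝ), (∀ j, 0 < ν j ∧ ν j ≤ 1 / 4) ∧ Tendsto ν atTop (𝓝 0) ∧ 0 < c ∧ LogLoudAlong f ν E c

/-- The `∀ f, f = f_TG → …` binder of the crux is sugar: crux ↔ its instance at `tgForce`. [folklore] -/
theorem logCrux_iff :
    Summit.AnomalousDissipation.AnomalousDissipation.Theses.MirrorVariety.TaylorGreenLogLoudStates ↔
      LogLoudStates tgForce := by
  constructor
  · intro h
    exact h tgForce rfl
  · rintro h f rfl
    exact h

/-! ## §1 Elementary facts about `log(1/ν)` on `0 < ν ≤ 1/4` -/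

/-- For `0 < ν ≤ 1/4`: `log 4 ≤ log(1/ν)`. [folklore] -/
theorem log_four_le_log_one_div {ν : ℝ} (h0 : 0 < ν) (h4 : ν ≤ 1 / 4) : Real.log 4 ≤ Real.log (1 / ν) := by
  refine Real.log_le_log (by norm_num) ?_
  rw [le_div_iff₀ h0]
  linarith

/-- For `0 < ν ≤ 1/4`: `0 < log(1/ν)`. [folklore] -/
theorem log_one_div_pos {ν : ℝ} (h0 : 0 < ν) (h4 : ν ≤ 1 / 4) : 0 < Real.log (1 / ν) :=
  (Real.log_pos (by norm_num : (1 : ℝ) < 4)).trans_le (log_four_le_log_one_div h0 h4)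

/-- `ν_j → 0` implies `ν_j · log(1/ν_j) → 0` (continuity of `x log x` at `0`, Mathlib's junk `log 0 = 0`). [folklore] -/
theorem tendsto_mul_log_one_div {ν : ℕ → ℝ} (hlim : Tendsto ν atTop (𝓝 0)) :
    Tendsto (fun j => ν j * Real.log (1 / ν j)) atTop (𝓝 0) := by
  have h1 : Tendsto (fun j => ν j * Real.log (ν j)) atTop (𝓝 (0 * Real.log 0)) :=
    (Real.continuous_mul_log.tendsto 0).comp hlim
  rw [zero_mul] at h1
  have h2 : (fun j => ν j * Real.log (1 / ν j)) = fun j => -(ν j * Real.log (ν j)) := by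
    funext j
    rw [one_div, Real.log_inv]
    ring
  rw [h2]
  simpa using h1.neg

/-- `ν_j → 0⁺` implies `log(1/ν_j) → +∞`. [folklore] -/
theorem tendsto_log_one_div_atTop {ν : ℕ → ℝ} (hpos : ∀ j, 0 < ν j) (hlim : Tendsto ν atTop (𝓝 0)) :
    Tendsto (fun j => Real.log (1 / ν j)) atTop atTop := by
  have hν : Tendsto ν atTop (𝓝[>] 0) :=
    tendsto_nhdsWithin_iff.2 ⟨hlim, Eventually.of_forall fun j => hpos j⟩
  have h1 : Tendsto (fun j => 1 / ν j) atTop atTop := by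
    refine hν.inv_tendsto_nhdsGT_zero.congr fun j => ?_
    simp [one_div]
  exact Real.tendsto_log_atTop.comp h1

/-! ## §2 Load-bearing analysis and refuted strengthenings

### (a) The force hypothesis is load-bearing -/

/-- The crux with its only hypothesis (`f = f_TG`) dropped, i.e. weakened to "every smooth div-free mean-zero force has
log-loud Galerkin steady states". -/
def TaylorGreenLogLoudStatesWithoutForce : Prop :=
  ∀ f : UnitAddTorus (Fin 3) → EuclideanSpace ℝ (Fin 3), IsSmooth f → IsDivFree f → HasZeroMean f → LogLoudStates f

/-- No log-loud Galerkin steady states for the zero force: loudness equals injection, which vanishes — whatever the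
energy budget. [folklore] -/
theorem not_logLoudStates_zero :
    ¬ LogLoudStates (fun _ : UnitAddTorus (Fin 3) => (0 : EuclideanSpace ℝ (Fin 3))) := by
  rintro ⟨ν, E, c, -, -, hc, h⟩
  obtain ⟨N, U, hU, -, hloud⟩ := (h 0).exists
  have hid := energy_identity hU continuous_const
  simp only [inner_zero_left, integral_zero] at hid
  linarith

/-- **Any proof must use the force.** The force-free weakening of the crux is false (witness `f = 0`). [folklore] -/
theorem logLoud_false_without_force : ¬ TaylorGreenLogLoudStatesWithoutForce := fun h =>
  not_logLoudStates_zero (h _ (isSmooth_const _) isDivFree_zero (by simp [HasZeroMean]))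

/-! ### (b) The constants window -/

/-- **Log window.** Every witness `(ν, E, c)` of the log-loud matrix for `f_TG` has `4c² ≤ E·log(1/ν_j)` for EVERY `j`
(`c ≤ ν_j‖∇U‖² ≤ ½√(∫|U|²) ≤ ½√(E log(1/ν_j))`, sibling `loudness_le_half_sqrt_energy`). [folklore] -/
theorem log_window {ν : ℕ → ℝ} {E c : ℝ} (hc : 0 < c) (h : LogLoudAlong tgForce ν E c) (j : ℕ) :
    4 * c ^ 2 ≤ E * Real.log (1 / ν j) := by
  obtain ⟨N, U, hU, hUE, hloud⟩ := (h j).exists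
  have h1 := loudness_le_half_sqrt_energy hU
  have h2 : Real.sqrt (∫ x, ‖U x‖ ^ 2) ≤ Real.sqrt (E * Real.log (1 / ν j)) := Real.sqrt_le_sqrt hUE
  have h3 : 2 * c ≤ Real.sqrt (E * Real.log (1 / ν j)) := by linarith
  have h4 := (Real.le_sqrt' (by positivity)).1 h3
  calc 4 * c ^ 2 = (2 * c) ^ 2 := by ring
    _ ≤ E * Real.log (1 / ν j) := h4

/-- **`E > 0` is forced** (from the window at `j = 0` and `log(1/ν_0) > 0`). [folklore] -/
theorem logLoud_pos_E {ν : ℕ → ℝ} {E c : ℝ} (hν : ∀ j, 0 < ν j ∧ ν j ≤ 1 / 4) (hc : 0 < c)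
    (h : LogLoudAlong tgForce ν E c) : 0 < E := by
  have h1 := log_window hc h 0
  have hlog := log_one_div_pos (hν 0).1 (hν 0).2
  by_contra hE
  push Not at hE
  nlinarith [mul_le_mul_of_nonneg_right hE hlog.le, sq_nonneg c]

/-- **Natural strengthening refuted: too little energy at some `j`.** The crux with the extra clause
`E·log(1/ν_j) < 4c²` for some `j` is FALSE for the Taylor–Green force. [folklore] -/
theorem not_logLoud_of_energy_lt_four_sq :
    ¬ ∃ (ν : ℕ → ℝ) (E c : ℝ), (∀ j, 0 < ν j ∧ ν j ≤ 1 / 4) ∧ Tendsto ν atTop (𝓝 0) ∧ 0 < c ∧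
        (∃ j, E * Real.log (1 / ν j) < 4 * c ^ 2) ∧ LogLoudAlong tgForce ν E c := by
  rintro ⟨ν, E, c, -, -, hc, ⟨j, hj⟩, h⟩
  exact absurd (log_window hc h j) (not_le.2 hj)

/-- **Natural strengthening refuted: loudness growing like the energy budget.** With energy `≤ E·log(1/ν_j)` the
loudness cannot be `≥ c·log(1/ν_j)` along `ν_j → 0⁺` (exponent `1`; the injection ceiling allows at most `½√(E log)`,
exponent `½`): `4c²log(1/ν_j) ≤ E` for every `j` while `log(1/ν_j) → ∞`. [folklore] -/
theorem not_logLoud_linear_loudness :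
    ¬ ∃ (ν : ℕ → ℝ) (E c : ℝ), (∀ j, 0 < ν j ∧ ν j ≤ 1 / 4) ∧ Tendsto ν atTop (𝓝 0) ∧ 0 < c ∧
        ∀ j, ∀ᶠ N in atTop, ∃ U : UnitAddTorus (Fin 3) → EuclideanSpace ℝ (Fin 3),
          IsSteadyState (ν j) N tgForce U ∧ ∫ x, ‖U x‖ ^ 2 ≤ E * Real.log (1 / ν j) ∧
            c * Real.log (1 / ν j) ≤ ν j * gradNormSq U := by
  rintro ⟨ν, E, c, hν, hlim, hc, h⟩
  have hb : ∀ j, 4 * c ^ 2 * Real.log (1 / ν j) ≤ E := by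
    intro j
    obtain ⟨N, U, hU, hUE, hloud⟩ := (h j).exists
    have hlog := log_one_div_pos (hν j).1 (hν j).2
    have h1 := loudness_le_half_sqrt_energy hU
    have h2 : Real.sqrt (∫ x, ‖U x‖ ^ 2) ≤ Real.sqrt (E * Real.log (1 / ν j)) := Real.sqrt_le_sqrt hUE
    have h3 : 2 * (c * Real.log (1 / ν j)) ≤ Real.sqrt (E * Real.log (1 / ν j)) := by linarith
    have h4 := (Real.le_sqrt' (by positivity)).1 h3
    have h5 : (4 * c ^ 2 * Real.log (1 / ν j)) * Real.log (1 / ν j) ≤ E * Real.log (1 / ν j) := by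
      nlinarith [h4]
    exact le_of_mul_le_mul_right h5 hlog
  have hT : Tendsto (fun j => 4 * c ^ 2 * Real.log (1 / ν j)) atTop atTop :=
    (tendsto_log_one_div_atTop (fun j => (hν j).1) hlim).const_mul_atTop (by positivity)
  obtain ⟨j, hj⟩ := (hT.eventually_gt_atTop E).exists
  exact absurd (hb j) (not_le.2 hj)

/-! ### (c) The resolution -/

/-- **Log resolution floor.** A witness state at `(ν, N)` (any force) forces `c ≤ 4π² ν N² · E log(1/ν)`, i.e.
`N ≥ (c / 4π²E ν log(1/ν))^{1/2} → ∞` as `ν → 0⁺`. [folklore] -/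
theorem log_resolution_floor {ν E c : ℝ} {N : ℕ} {f U : UnitAddTorus (Fin 3) → EuclideanSpace ℝ (Fin 3)}
    (hν : 0 ≤ ν) (hU : IsSteadyState ν N f U) (hE : ∫ x, ‖U x‖ ^ 2 ≤ E * Real.log (1 / ν))
    (hloud : c ≤ ν * gradNormSq U) :
    c ≤ 4 * Real.pi ^ 2 * ν * (N : ℝ) ^ 2 * (E * Real.log (1 / ν)) :=
  resolution_floor hν hU hE hloud

/-- **Natural strengthening refuted: `∀ N` in place of `∀ᶠ N`** (any force): at `N = 0` the only admissible state is
quiet (`‖∇U‖² ≤ 4π²·0·∫|U|²`). [folklore] -/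
theorem not_logLoud_at_every_resolution (f : UnitAddTorus (Fin 3) → EuclideanSpace ℝ (Fin 3)) :
    ¬ ∃ (ν : ℕ → ℝ) (E c : ℝ), (∀ j, 0 < ν j ∧ ν j ≤ 1 / 4) ∧ Tendsto ν atTop (𝓝 0) ∧ 0 < c ∧
        ∀ j N, ∃ U : UnitAddTorus (Fin 3) → EuclideanSpace ℝ (Fin 3),
          IsSteadyState (ν j) N f U ∧ ∫ x, ‖U x‖ ^ 2 ≤ E * Real.log (1 / ν j) ∧ c ≤ ν j * gradNormSq U := by
  rintro ⟨ν, E, c, hν, -, hc, h⟩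
  obtain ⟨U, hU, hUE, hloud⟩ := h 0 0
  have h1 := resolution_floor (hν 0).1.le hU hUE hloud
  simp only [Nat.cast_zero] at h1
  nlinarith [h1]

/-- The Taylor–Green shell has `|k|² = 3`. [folklore] -/
theorem freqNormSq_of_mem_tgShell {k : Fin 3 → ℤ} (hk : k ∈ tgShell) : freqNormSq k = 3 := by
  have h1 : ∀ i, ((k i : ℤ) : ℝ) ^ 2 = 1 := by
    intro i
    have hi : k i ∈ ({1, -1} : Finset ℤ) := by
      have h := hk
      simp only [tgShell, Fintype.mem_piFinset] at h
      exact h i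
    simp only [Finset.mem_insert, Finset.mem_singleton] at hi
    rcases hi with h | h <;> simp [h]
  simp only [freqNormSq, h1, Finset.sum_const, Finset.card_univ, Fintype.card_fin]
  norm_num

/-- **TG-specific: at resolution `N ≤ 1` the Galerkin system is unforced.** The forcing shell `|k|² = 3` lies outside
the ball `|k|² ≤ 1`, so EVERY admissible Taylor–Green state at `N ≤ 1` has zero injection, `ν‖∇U‖² = ∫⟪f_TG,U⟫ = 0`.
[folklore] -/
theorem injection_eq_zero_of_resolution_le_one {ν : ℝ} {N : ℕ} (hN : N ≤ 1)
    {U : UnitAddTorus (Fin 3) → EuclideanSpace ℝ (Fin 3)} (hU : IsSteadyState ν N tgForce U) :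
    ν * gradNormSq U = 0 := by
  rw [energy_identity hU continuous_tgForce,
    integral_inner_tgForce_eq_sum (hU.1.continuous.memLp_of_hasCompactSupport (HasCompactSupport.of_compactSpace _))]
  refine Finset.sum_eq_zero fun k hk => ?_
  have hk0 : UnitAddTorus.mFourierCoeff (EuclideanSpace.complexify ∘ U) k = 0 := by
    refine hU.2.2.2.1 k fun hmem => ?_
    have hball : freqNormSq k ≤ (N : ℝ) ^ 2 := mem_freqBall.1 (Finset.mem_of_mem_erase hmem)
    have hN' : (N : ℝ) ^ 2 ≤ 1 := by
      have : (N : ℝ) ≤ 1 := by exact_mod_cast hN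
      exact pow_le_one₀ (Nat.cast_nonneg N) this
    rw [freqNormSq_of_mem_tgShell hk] at hball
    linarith
  rw [hk0, inner_zero_right, Complex.zero_re]

/-- **Natural strengthening refuted: `∀ N ≥ 1`** — no admissible Taylor–Green state at resolution `N ≤ 1` is loud, at ANY
viscosity and energy: the threshold hidden in `∀ᶠ N` is `≥ 2` for every `j` (and `→ ∞` by `log_resolution_floor`).
[folklore] -/
theorem not_loud_at_resolution_le_one {ν c : ℝ} {N : ℕ} (hN : N ≤ 1) (hc : 0 < c)
    {U : UnitAddTorus (Fin 3) → EuclideanSpace ℝ (Fin 3)} (hU : IsSteadyState ν N tgForce U) :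
    ¬ c ≤ ν * gradNormSq U := by
  rw [injection_eq_zero_of_resolution_le_one hN hU]
  exact not_le.2 hc

/-- **Natural strengthening refuted: one resolution for all `j`** (any force): `c ≤ 4π²N²E · ν_j log(1/ν_j) → 0`.
[folklore] -/
theorem not_logLoud_at_fixed_resolution (f : UnitAddTorus (Fin 3) → EuclideanSpace ℝ (Fin 3)) :
    ¬ ∃ (ν : ℕ → ℝ) (E c : ℝ) (N : ℕ), (∀ j, 0 < ν j ∧ ν j ≤ 1 / 4) ∧ Tendsto ν atTop (𝓝 0) ∧ 0 < c ∧
        ∀ j, ∃ U : UnitAddTorus (Fin 3) → EuclideanSpace ℝ (Fin 3),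
          IsSteadyState (ν j) N f U ∧ ∫ x, ‖U x‖ ^ 2 ≤ E * Real.log (1 / ν j) ∧ c ≤ ν j * gradNormSq U := by
  rintro ⟨ν, E, c, N, hν, hlim, hc, h⟩
  have hbound : ∀ j, c ≤ 4 * Real.pi ^ 2 * (N : ℝ) ^ 2 * E * (ν j * Real.log (1 / ν j)) := fun j => by
    obtain ⟨U, hU, hE, hloud⟩ := h j
    calc c ≤ 4 * Real.pi ^ 2 * ν j * (N : ℝ) ^ 2 * (E * Real.log (1 / ν j)) :=
          resolution_floor (hν j).1.le hU hE hloud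
      _ = 4 * Real.pi ^ 2 * (N : ℝ) ^ 2 * E * (ν j * Real.log (1 / ν j)) := by ring
  have hT : Tendsto (fun j => 4 * Real.pi ^ 2 * (N : ℝ) ^ 2 * E * (ν j * Real.log (1 / ν j))) atTop
      (𝓝 (4 * Real.pi ^ 2 * (N : ℝ) ^ 2 * E * 0)) :=
    tendsto_const_nhds.mul (tendsto_mul_log_one_div hlim)
  rw [mul_zero] at hT
  have : c ≤ 0 := ge_of_tendsto' hT hbound
  linarith

/-- **Natural strengthening refuted: the quantifier swap** (any force). The crux's `∀ j, ∀ᶠ N` cannot be strengthened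
to `∀ᶠ N, ∀ j` (a `j`-uniform resolution threshold). [folklore] -/
theorem not_logLoud_uniformly_in_resolution (f : UnitAddTorus (Fin 3) → EuclideanSpace ℝ (Fin 3)) :
    ¬ ∃ (ν : ℕ → ℝ) (E c : ℝ), (∀ j, 0 < ν j ∧ ν j ≤ 1 / 4) ∧ Tendsto ν atTop (𝓝 0) ∧ 0 < c ∧
        ∀ᶠ N in atTop, ∀ j, ∃ U : UnitAddTorus (Fin 3) → EuclideanSpace ℝ (Fin 3),
          IsSteadyState (ν j) N f U ∧ ∫ x, ‖U x‖ ^ 2 ≤ E * Real.log (1 / ν j) ∧ c ≤ ν j * gradNormSq U := by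
  rintro ⟨ν, E, c, hν, hlim, hc, h⟩
  obtain ⟨N, hN⟩ := h.exists
  exact not_logLoud_at_fixed_resolution f ⟨ν, E, c, N, hν, hlim, hc, hN⟩

end Summit.AnomalousDissipation.AnomalousDissipation.Theorems.TaylorGreenLogLoudStates.Negative

end
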